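import Literature.NumberTheory.DiophantineGeometry.MinimalDiscriminantNormProofs
import Literature.NumberTheory.DiophantineGeometry.MinimalDiscriminantProofs
import Literature.NumberTheory.EllipticCurves.SzpiroLocalDataProofs
import Mathlib.NumberTheory.RamificationInertia.Valuation
import Mathlib.NumberTheory.NumberField.Basic
import HarnessLib

/-!
# The minimal discriminant exponent under base change is congruent to `e(w∣v)·ord_v(Δ_min)`
# modulo `12`; good reduction over an extension forces `12 ∣ e(w∣v)·ord_v(Δ_min)` — PROVED

Topic `NumberTheory/DiophantineGeometry` (notion `WeierstrassCurve.ordMinimalDiscriminant` of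
`MinimalDiscriminant`, place-level reduction predicates of `LocalReduction`). Theorems only (no
definition, no named fact, no instance), in the `AKLB` setting of Mathlib's
`IsDedekindDomain.HeightOneSpectrum.valuation_liesOver` (Dedekind domains `A ⊆ K`, `B ⊆ L`, `L/K` an
extension, `w` a finite place of `B` over the finite place `v` of `A`; number fields are an instance)
and, in §3, for curves over `ℚ` (`v : HeightOneSpectrum ℤ`, `p = natGenerator v`).

Source: J. H. Silverman, *The Arithmetic of Elliptic Curves*, GTM 106, 2nd ed. 2009
[SilvermanAEC2009]: VII.1 Remark 1.1 and Table 3.1 ("`u¹²Δ' = Δ`": an admissible change of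
variables changes `ord_v(Δ)` by a multiple of `12`), VII.1 Prop. 1.3 (minimal equations), VII.5
Prop. 5.1 (a) (good reduction `⟺ ord_v(Δ_min) = 0`), VII.5 Prop. 5.4 and its proof (base change:
`v'(x) = e·v(x)` on `K`). Written for the `bsd-2adic` cell (WIDTH-LEVER lane B on the additive-at-2
crux: which number fields can be fields of good reduction above `2`), classical and of general use.

## What is PROVED

* §1 **`WeierstrassCurve.twelve_dvd_ordMinimalDiscriminant_add_log_valuation_Δ`** — for EVERY
  equation `W` of an elliptic curve over the fraction field `K` of a Dedekind domain and every finite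
  place `v`: `12 ∣ ord_v(Δ_min) − ord_v(Δ(W))` (model-free: `W` need not be `v`-integral; in the value
  group `ℤᵐ⁰`, `ord_v(Δ(W)) = −log |Δ(W)|_v`).
* §2 **`WeierstrassCurve.twelve_dvd_ramificationIdx_mul_ordMinimalDiscriminant_sub`** — `w ∣ v` in an
  extension `L/K`: `12 ∣ e(w∣v)·ord_v(Δ_min(W)) − ord_w(Δ_min(W_L))`; hence
  **`twelve_dvd_ramificationIdx_mul_ordMinimalDiscriminant_of_hasGoodReductionAt`** — if `W_L` has
  GOOD reduction at `w` then `12 ∣ e(w∣v)·ord_v(Δ_min(W))` — and the obstructions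
  `not_hasGoodReductionAt_baseChange_of_not_twelve_dvd`, `…_of_not_three_dvd` (`3 ∤ ord_v(Δ_min)` and
  `3 ∤ e(w∣v)` ⟹ `W_L` is not good at `w`), `…_of_odd_of_not_four_dvd` (`ord_v(Δ_min)` odd and
  `4 ∤ e(w∣v)` ⟹ not good).
* §3 over `ℚ`: **`Rat.log_valuation_eq_neg_padicValRat`** (`log |q|_v = −ord_p(q)`),
  `twelve_dvd_ordMinimalDiscriminant_sub_padicValRat_Δ` (`ord_p(Δ_min) ≡ ord_p(Δ(W)) (mod 12)` for any
  model), and for a number field `K` and a place `w` of `K` over `p`: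
  **`twelve_dvd_ramificationIdx_mul_padicValRat_Δ_of_hasGoodReductionAt`**,
  **`not_hasGoodReductionAt_baseChange_of_not_three_dvd_padicValRat_Δ`**,
  `not_hasGoodReductionAt_baseChange_of_odd_padicValRat_Δ_of_not_four_dvd`.

USE (cell `bsd-2adic`, crux `AdditiveRankZeroAtTwo`): an elliptic curve over `ℚ` with `3 ∤ ord₂(Δ)`
(semistability defect `Φ ⊇ C₃` at `2`: `C₃`, `C₆`, `SL₂(𝔽₃)`) acquires good reduction at a place
`w ∣ 2` of a number field `K` only if `3 ∣ e(w∣2)`; since every finite ABELIAN extension of `ℚ₂` has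
ramification index a power of `2` (local Kronecker–Weber), no abelian number field — the habitat of
Kato's Euler system — is a field of good reduction above `2` for such a curve. (That last sentence is
print, not a theorem of this file.)

[cite: SilvermanAEC2009, VII.1 Remark 1.1, Prop. 1.3; VII.5 Prop. 5.1 (a), Prop. 5.4 (proof)]
[cite: SerreLocalFields1979, Ch. I §4 (`|x|_w = |x|_v^{e(w∣v)}`)]
-/

noncomputable section

open scoped Classical
open IsDedekindDomain

namespace WeierstrassCurve

/-! ## §1. `ord_v(Δ(W)) ≡ ord_v(Δ_min) (mod 12)` for every equation of an elliptic curve -/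

section Local

variable {A : Type*} [CommRing A] [IsDedekindDomain A] {K : Type*} [Field K] [Algebra A K]
  [IsFractionRing A K] (v : HeightOneSpectrum A) (W : WeierstrassCurve K)

/-- **`12 ∣ ord_v(Δ_min) + log |Δ(W)|_v`**, i.e. `ord_v(Δ(W)) ≡ ord_v(Δ_min) (mod 12)`, for EVERY
Weierstrass equation `W` of an elliptic curve over the fraction field of a Dedekind domain and every
finite place `v` (no integrality hypothesis on `W`). Proof: the chosen local minimal model is
`M = E • W_{K_v}` for a change of variables `E` over `K_v`, so `Δ(M) = u⁻¹² Δ(W)` (Silverman VII.1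
Table 3.1), `|Δ(M)|_v = exp(−ord_v Δ_min)` (definition of `ordMinimalDiscriminant` through the integral
model, bridge `exists_addVal_adicCompletionIntegers_eq`), and `|u⁻¹|_v = exp(k)` for some `k ∈ ℤ`.
[cite: SilvermanAEC2009, VII.1 Remark 1.1 and Prop. 1.3] -/
theorem twelve_dvd_ordMinimalDiscriminant_add_log_valuation_Δ [W.IsElliptic] :
    (12 : ℤ) ∣ (W.ordMinimalDiscriminant v : ℤ) + WithZero.log (v.valuation K W.Δ) := by
  set Ov := v.adicCompletionIntegers K
  set Kv := v.adicCompletion K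
  set X := W.baseChange Kv with hX
  obtain ⟨E, hE⟩ : ∃ E : VariableChange Kv, W.localMinimalModel v = E • X := ⟨_, rfl⟩
  set M := W.localMinimalModel v with hM
  haveI hMell : M.IsElliptic := by
    rw [hM]; unfold localMinimalModel minimal baseChange; infer_instance
  -- `Δ(M) = u⁻¹² · Δ(W)` and the valuations of the three factors
  have hMΔ' : M.Δ = (↑E.u⁻¹ : Kv) ^ 12 * X.Δ := by rw [hE, variableChange_Δ]
  have hXΔ : Valued.v X.Δ = v.valuation K W.Δ := by
    rw [hX, WeierstrassCurve.baseChange, map_Δ]; exact valued_algebraMap_adicCompletion v W.Δ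
  have hΔ0 : v.valuation K W.Δ ≠ 0 := (Valuation.ne_zero_iff _).mpr W.isUnit_Δ.ne_zero
  have hIΔ : algebraMap Ov Kv (W.localMinimalIntegralModel v).Δ = M.Δ := integralModel_Δ_eq Ov _
  have hI0 : (W.localMinimalIntegralModel v).Δ ≠ 0 := by
    intro h
    have hM0 : M.Δ = 0 := by rw [← hIΔ, h, map_zero]
    exact M.isUnit_Δ.ne_zero hM0
  obtain ⟨n, hn, hvn⟩ := HeightOneSpectrum.exists_addVal_adicCompletionIntegers_eq K v _ hI0
  have hord : W.ordMinimalDiscriminant v = n := by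
    rw [ordMinimalDiscriminant, hn]; rfl
  have hvM : Valued.v M.Δ = WithZero.exp (-(n : ℤ)) := by rw [← hIΔ]; exact hvn
  set a : WithZero (Multiplicative ℤ) := Valued.v (↑E.u⁻¹ : Kv) with ha
  have ha0 : a ≠ 0 := (Valuation.ne_zero_iff _).mpr (Units.ne_zero _)
  have key : WithZero.exp (-(n : ℤ)) = a ^ 12 * v.valuation K W.Δ := by
    rw [← hvM, hMΔ', map_mul, map_pow, hXΔ]
  have hlog := congrArg WithZero.log key
  rw [WithZero.log_exp, WithZero.log_mul (pow_ne_zero _ ha0) hΔ0, WithZero.log_pow,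
    nsmul_eq_mul] at hlog
  refine ⟨-WithZero.log a, ?_⟩
  rw [hord]
  push_cast at hlog ⊢
  linarith

/-- `ord_v(Δ_min) ≤ ord_v(Δ(W))` fails to be an equality exactly by a multiple of `12`: the
congruence of `twelve_dvd_ordMinimalDiscriminant_add_log_valuation_Δ` in `−log` form,
`12 ∣ ord_v(Δ_min) − (−log |Δ(W)|_v)`. [cite: SilvermanAEC2009, VII.1 Remark 1.1 and Prop. 1.3] -/
theorem twelve_dvd_ordMinimalDiscriminant_sub_neg_log_valuation_Δ [W.IsElliptic] :
    (12 : ℤ) ∣ (W.ordMinimalDiscriminant v : ℤ) - (-WithZero.log (v.valuation K W.Δ)) := by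
  rw [sub_neg_eq_add]; exact W.twelve_dvd_ordMinimalDiscriminant_add_log_valuation_Δ v

end Local

/-! ## §2. Base change: `12 ∣ e(w∣v)·ord_v(Δ_min(W)) − ord_w(Δ_min(W_L))`; good reduction upstairs -/

section BaseChange

/- Mathlib's `AKLB` setting of `IsDedekindDomain.HeightOneSpectrum.valuation_liesOver`. -/
variable {A K : Type*} (L : Type*) {B : Type*} [CommRing A] [IsDedekindDomain A] [CommRing B]
  [IsDedekindDomain B] [Algebra A B] [Module.IsTorsionFree A B] [Field K] [Field L] [Algebra K L]
  [Algebra A K] [IsFractionRing A K] [Algebra A L] [IsScalarTower A K L] [Algebra B L]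
  [IsFractionRing B L] [IsScalarTower A B L] (v : HeightOneSpectrum A) (w : HeightOneSpectrum B)
  [w.asIdeal.LiesOver v.asIdeal] (W : WeierstrassCurve K)

/-- **`12 ∣ e(w∣v)·ord_v(Δ_min(W)) − ord_w(Δ_min(W_L))`** for an elliptic `W/K`, a finite place `v` of
`K` and a place `w ∣ v` of the extension `L`: both `e(w∣v)·ord_v(Δ_min(W))` and `ord_w(Δ_min(W_L))`
are congruent modulo `12` to `ord_w(Δ(W)) = e(w∣v)·ord_v(Δ(W))` (`|x|_w = |x|_v^{e(w∣v)}`, Mathlib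
`valuation_liesOver`; §1 at `v` and at `w`). [cite: SilvermanAEC2009, VII.1 Remark 1.1; VII.5 Prop. 5.4 (proof)] -/
theorem twelve_dvd_ramificationIdx_mul_ordMinimalDiscriminant_sub [W.IsElliptic] :
    (12 : ℤ) ∣ (v.asIdeal.ramificationIdx' w.asIdeal : ℤ) * W.ordMinimalDiscriminant v
      - (W.baseChange L).ordMinimalDiscriminant w := by
  haveI : (W.baseChange L).IsElliptic := inferInstanceAs ((W.map (algebraMap K L)).IsElliptic)
  have h1 := W.twelve_dvd_ordMinimalDiscriminant_add_log_valuation_Δ v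
  have h2 := (W.baseChange L).twelve_dvd_ordMinimalDiscriminant_add_log_valuation_Δ w
  have hΔ : (W.baseChange L).Δ = algebraMap K L W.Δ := by rw [baseChange, map_Δ]
  rw [hΔ, ← HeightOneSpectrum.valuation_liesOver L v w W.Δ, WithZero.log_pow, nsmul_eq_mul] at h2
  have h := (h1.mul_left (v.asIdeal.ramificationIdx' w.asIdeal : ℤ)).sub h2
  have key : (v.asIdeal.ramificationIdx' w.asIdeal : ℤ) * W.ordMinimalDiscriminant v
      - (W.baseChange L).ordMinimalDiscriminant w =
      (v.asIdeal.ramificationIdx' w.asIdeal : ℤ) *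
          ((W.ordMinimalDiscriminant v : ℤ) + WithZero.log (v.valuation K W.Δ)) -
        (((W.baseChange L).ordMinimalDiscriminant w : ℤ) +
          (v.asIdeal.ramificationIdx' w.asIdeal : ℤ) * WithZero.log (v.valuation K W.Δ)) := by
    ring
  rw [key]
  exact h

/-- **Good reduction over the extension forces `12 ∣ e(w∣v)·ord_v(Δ_min)`**: if the base change
`W_L` of the elliptic curve `W/K` has GOOD reduction at a place `w ∣ v`, then `12` divides
`e(w∣v)·ord_v(Δ_min(W))` (`ord_w(Δ_min(W_L)) = 0` at a good place, Silverman VII.5.1 (a)).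
[cite: SilvermanAEC2009, VII.5 Prop. 5.1 (a) and Prop. 5.4 (proof)] -/
theorem twelve_dvd_ramificationIdx_mul_ordMinimalDiscriminant_of_hasGoodReductionAt [W.IsElliptic]
    (h : (W.baseChange L).HasGoodReductionAt w) :
    (12 : ℤ) ∣ (v.asIdeal.ramificationIdx' w.asIdeal : ℤ) * W.ordMinimalDiscriminant v := by
  haveI : (W.baseChange L).IsElliptic := inferInstanceAs ((W.map (algebraMap K L)).IsElliptic)
  have h0 : (W.baseChange L).ordMinimalDiscriminant w = 0 :=
    (ordMinimalDiscriminant_eq_zero_iff_holds w (W.baseChange L)).mpr h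
  have h12 := W.twelve_dvd_ramificationIdx_mul_ordMinimalDiscriminant_sub L v w
  rw [h0, Nat.cast_zero, sub_zero] at h12
  exact h12

/-- **Obstruction to good reduction over an extension**: if `12 ∤ e(w∣v)·ord_v(Δ_min(W))` then `W_L`
does NOT have good reduction at `w`. [cite: SilvermanAEC2009, VII.5 Prop. 5.1 (a) and Prop. 5.4 (proof)] -/
theorem not_hasGoodReductionAt_baseChange_of_not_twelve_dvd [W.IsElliptic]
    (h : ¬ (12 : ℤ) ∣ (v.asIdeal.ramificationIdx' w.asIdeal : ℤ) * W.ordMinimalDiscriminant v) :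
    ¬ (W.baseChange L).HasGoodReductionAt w := fun hg =>
  h (W.twelve_dvd_ramificationIdx_mul_ordMinimalDiscriminant_of_hasGoodReductionAt L v w hg)

/-- **The tame-cubic obstruction**: if `3 ∤ ord_v(Δ_min(W))` and `3 ∤ e(w∣v)`, then `W_L` does NOT have
good reduction at `w` (a field of good reduction must have ramification index divisible by `3` over
such a place). [cite: SilvermanAEC2009, VII.5 Prop. 5.1 (a) and Prop. 5.4 (proof)] -/
theorem not_hasGoodReductionAt_baseChange_of_not_three_dvd [W.IsElliptic]
    (hW : ¬ 3 ∣ W.ordMinimalDiscriminant v) (he : ¬ 3 ∣ v.asIdeal.ramificationIdx' w.asIdeal) :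
    ¬ (W.baseChange L).HasGoodReductionAt w := by
  refine W.not_hasGoodReductionAt_baseChange_of_not_twelve_dvd L v w fun h12 => ?_
  have h3 : (3 : ℤ) ∣ (v.asIdeal.ramificationIdx' w.asIdeal : ℤ) * W.ordMinimalDiscriminant v :=
    (show (3 : ℤ) ∣ 12 by norm_num).trans h12
  rcases Int.prime_three.dvd_mul.mp h3 with h | h
  · exact he (by exact_mod_cast h)
  · exact hW (by exact_mod_cast h)

/-- **The wild-quartic obstruction**: if `ord_v(Δ_min(W))` is odd and `4 ∤ e(w∣v)`, then `W_L` does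
NOT have good reduction at `w`. [cite: SilvermanAEC2009, VII.5 Prop. 5.1 (a) and Prop. 5.4 (proof)] -/
theorem not_hasGoodReductionAt_baseChange_of_odd_of_not_four_dvd [W.IsElliptic]
    (hW : Odd (W.ordMinimalDiscriminant v)) (he : ¬ 4 ∣ v.asIdeal.ramificationIdx' w.asIdeal) :
    ¬ (W.baseChange L).HasGoodReductionAt w := by
  refine W.not_hasGoodReductionAt_baseChange_of_not_twelve_dvd L v w fun h12 => ?_
  have h4 : (4 : ℤ) ∣ (v.asIdeal.ramificationIdx' w.asIdeal : ℤ) * W.ordMinimalDiscriminant v :=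
    (show (4 : ℤ) ∣ 12 by norm_num).trans h12
  obtain ⟨k, hk⟩ := hW
  have hcop : IsCoprime (4 : ℤ) (W.ordMinimalDiscriminant v : ℤ) := by
    rw [hk]; push_cast; exact ⟨(k : ℤ) ^ 2, 1 - 2 * k, by ring⟩
  exact he (by exact_mod_cast hcop.dvd_of_dvd_mul_right h4)

end BaseChange

/-! ## §3. Curves over `ℚ`: `ord_p` of the discriminant of ANY model, and number fields -/

section Rat

open Rat.HeightOneSpectrum

/-- **`log |q|_v = −ord_p(q)`** for a nonzero rational `q` at the place `v` of `ℤ` with rational prime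
`p = natGenerator v` below it (`|·|_v` Mathlib's `v.valuation ℚ` with values in `ℤᵐ⁰`, `ord_p` Mathlib's
`padicValRat`): the exponential valuation of `ℚ` attached to the prime ideal `(p)` of the Dedekind
domain `ℤ` is the `p`-adic valuation `v_p` (Neukirch, *Algebraic Number Theory*, Ch. I §11
(valuations `v_𝔭` of a Dedekind domain) and Ch. II §1–§2 (the `p`-adic valuation of `ℚ`)).
[cite: NeukirchANT1999, Ch. I §11 and Ch. II §2 (the exponential valuation `v_p` on `ℚ`)] -/
theorem _root_.Literature.NumberTheory.DiophantineGeometry.Rat.log_valuation_eq_neg_padicValRat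
    (v : HeightOneSpectrum ℤ) {q : ℚ} (hq : q ≠ 0) :
    WithZero.log (v.valuation ℚ q) = -padicValRat (natGenerator v) q := by
  haveI : Fact (natGenerator v).Prime := ⟨prime_natGenerator v⟩
  -- integers first
  have hint : ∀ n : ℤ, n ≠ 0 → WithZero.log (v.valuation ℚ (n : ℚ)) = -(padicValInt (natGenerator v) n : ℤ) := by
    intro n hn
    have hv0 : v.valuation ℚ (n : ℚ) ≠ 0 :=
      (Valuation.ne_zero_iff _).mpr (Int.cast_ne_zero.mpr hn)
    obtain ⟨m, hm⟩ : ∃ m : ℤ, v.valuation ℚ (n : ℚ) = WithZero.exp m :=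
      ⟨_, (WithZero.exp_log hv0).symm⟩
    rw [hm, WithZero.log_exp]
    have hle : v.valuation ℚ (n : ℚ) ≤ WithZero.exp (-(padicValInt (natGenerator v) n : ℤ)) :=
      (Literature.NumberTheory.EllipticCurves.Rat.valuation_intCast_le_exp_iff v n _).mpr
        (padicValInt_dvd (p := natGenerator v) n)
    have hlt : ¬ v.valuation ℚ (n : ℚ) ≤
        WithZero.exp (-((padicValInt (natGenerator v) n + 1 : ℕ) : ℤ)) := by
      rw [Literature.NumberTheory.EllipticCurves.Rat.valuation_intCast_le_exp_iff v n]
      intro hd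
      rcases (padicValInt_dvd_iff _ _).mp hd with h | h
      · exact hn h
      · omega
    rw [hm, WithZero.exp_le_exp] at hle hlt
    push_cast at hlt
    omega
  -- then `q = num / den`
  have hnum : q.num ≠ 0 := Rat.num_ne_zero.mpr hq
  have hden : (q.den : ℤ) ≠ 0 := Int.natCast_ne_zero.mpr q.den_ne_zero
  have hq' : (q : ℚ) = (q.num : ℚ) / ((q.den : ℤ) : ℚ) := by
    push_cast; exact (Rat.num_div_den q).symm
  have hvnum : v.valuation ℚ (q.num : ℚ) ≠ 0 :=
    (Valuation.ne_zero_iff _).mpr (Int.cast_ne_zero.mpr hnum)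
  have hvden : v.valuation ℚ ((q.den : ℤ) : ℚ) ≠ 0 :=
    (Valuation.ne_zero_iff _).mpr (Int.cast_ne_zero.mpr hden)
  conv_lhs => rw [hq']
  rw [map_div₀, WithZero.log_div hvnum hvden, hint _ hnum, hint _ hden, padicValRat]
  simp only [padicValInt, Int.natAbs_natCast]
  ring

variable (W : WeierstrassCurve ℚ) (v : HeightOneSpectrum ℤ)

/-- **`ord_p(Δ_min) ≡ ord_p(Δ(W)) (mod 12)`** for EVERY equation `W` of an elliptic curve over `ℚ`
(integral or not) and every prime `p` (`v` the place of `ℤ` over `p = natGenerator v`).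
[cite: SilvermanAEC2009, VII.1 Remark 1.1 and Prop. 1.3] -/
theorem twelve_dvd_ordMinimalDiscriminant_sub_padicValRat_Δ [W.IsElliptic] :
    (12 : ℤ) ∣ (W.ordMinimalDiscriminant v : ℤ) - padicValRat (natGenerator v) W.Δ := by
  have h := W.twelve_dvd_ordMinimalDiscriminant_add_log_valuation_Δ v
  rwa [Literature.NumberTheory.DiophantineGeometry.Rat.log_valuation_eq_neg_padicValRat v
    W.isUnit_Δ.ne_zero, ← sub_eq_add_neg] at h

open NumberField

variable (K : Type*) [Field K] [NumberField K] (w : HeightOneSpectrum (𝓞 K))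
  [w.asIdeal.LiesOver v.asIdeal]

/-- **Good reduction above `p` over a number field forces `12 ∣ e(w∣p)·ord_p(Δ(W))`**: for an elliptic
curve over `ℚ` given by ANY equation `W`, a number field `K` and a finite place `w` of `K` over the
place `v` of `ℤ` (rational prime `p = natGenerator v`), if `W_K` has good reduction at `w` then
`12 ∣ e(w∣p)·ord_p(Δ(W))`. [cite: SilvermanAEC2009, VII.5 Prop. 5.1 (a) and Prop. 5.4 (proof); VII.1 Remark 1.1] -/
theorem twelve_dvd_ramificationIdx_mul_padicValRat_Δ_of_hasGoodReductionAt [W.IsElliptic]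
    (h : (W.baseChange K).HasGoodReductionAt w) :
    (12 : ℤ) ∣ (v.asIdeal.ramificationIdx' w.asIdeal : ℤ) * padicValRat (natGenerator v) W.Δ := by
  have h1 := W.twelve_dvd_ramificationIdx_mul_ordMinimalDiscriminant_of_hasGoodReductionAt K v w h
  have h2 := (W.twelve_dvd_ordMinimalDiscriminant_sub_padicValRat_Δ v).mul_left
    (v.asIdeal.ramificationIdx' w.asIdeal : ℤ)
  have h3 := h1.sub h2
  have key : (v.asIdeal.ramificationIdx' w.asIdeal : ℤ) * padicValRat (natGenerator v) W.Δ =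
      (v.asIdeal.ramificationIdx' w.asIdeal : ℤ) * W.ordMinimalDiscriminant v -
        (v.asIdeal.ramificationIdx' w.asIdeal : ℤ) *
          ((W.ordMinimalDiscriminant v : ℤ) - padicValRat (natGenerator v) W.Δ) := by
    ring
  rw [key]
  exact h3

/-- **No field of good reduction with `3 ∤ e(w∣p)` when `3 ∤ ord_p(Δ)`**: for an elliptic curve over
`ℚ` with `3 ∤ ord_p(Δ(W))` (any equation `W`; e.g. semistability defect `Φ ⊇ C₃` at `p = 2`), a number
field `K` and a place `w` of `K` over `p` with `3 ∤ e(w∣p)`, the base change `W_K` does NOT have good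
reduction at `w`. With local Kronecker–Weber (every finite abelian extension of `ℚ₂` has
ramification index a power of `2`) this excludes every ABELIAN number field as a field of good
reduction above `2` for such curves; that consequence is print and is not asserted here.
[cite: SilvermanAEC2009, VII.5 Prop. 5.1 (a) and Prop. 5.4 (proof); VII.1 Remark 1.1] -/
theorem not_hasGoodReductionAt_baseChange_of_not_three_dvd_padicValRat_Δ [W.IsElliptic]
    (hW : ¬ (3 : ℤ) ∣ padicValRat (natGenerator v) W.Δ)
    (he : ¬ 3 ∣ v.asIdeal.ramificationIdx' w.asIdeal) :
    ¬ (W.baseChange K).HasGoodReductionAt w := by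
  intro hg
  have h12 := W.twelve_dvd_ramificationIdx_mul_padicValRat_Δ_of_hasGoodReductionAt v K w hg
  have h3 : (3 : ℤ) ∣ (v.asIdeal.ramificationIdx' w.asIdeal : ℤ) * padicValRat (natGenerator v) W.Δ :=
    (show (3 : ℤ) ∣ 12 by norm_num).trans h12
  rcases Int.prime_three.dvd_mul.mp h3 with h | h
  · exact he (by exact_mod_cast h)
  · exact hW h

/-- **No field of good reduction with `4 ∤ e(w∣p)` when `ord_p(Δ)` is odd**: for an elliptic curve
over `ℚ` with `ord_p(Δ(W))` odd (any equation `W`), a number field `K` and a place `w` of `K` over `p`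
with `4 ∤ e(w∣p)`, the base change `W_K` does NOT have good reduction at `w`.
[cite: SilvermanAEC2009, VII.5 Prop. 5.1 (a) and Prop. 5.4 (proof); VII.1 Remark 1.1] -/
theorem not_hasGoodReductionAt_baseChange_of_odd_padicValRat_Δ_of_not_four_dvd [W.IsElliptic]
    (hW : Odd (padicValRat (natGenerator v) W.Δ))
    (he : ¬ 4 ∣ v.asIdeal.ramificationIdx' w.asIdeal) :
    ¬ (W.baseChange K).HasGoodReductionAt w := by
  intro hg
  have h12 := W.twelve_dvd_ramificationIdx_mul_padicValRat_Δ_of_hasGoodReductionAt v K w hg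
  have h4 : (4 : ℤ) ∣ (v.asIdeal.ramificationIdx' w.asIdeal : ℤ) * padicValRat (natGenerator v) W.Δ :=
    (show (4 : ℤ) ∣ 12 by norm_num).trans h12
  obtain ⟨k, hk⟩ := hW
  have he' : ¬ (4 : ℤ) ∣ (v.asIdeal.ramificationIdx' w.asIdeal : ℤ) := fun h => he (by exact_mod_cast h)
  apply he'
  have h2 : IsCoprime (4 : ℤ) (padicValRat (natGenerator v) W.Δ) := by
    rw [hk]
    exact ⟨k ^ 2, 1 - 2 * k, by ring⟩
  exact h2.dvd_of_dvd_mul_right h4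

end Rat

end WeierstrassCurve
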